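/-
COR-CM (cell pub-hodgecm2, stage 2 of the Hodge ladder) — junction B01 `PerLFace_of_PerL`: VACUITY DISCIPLINE for the two
displayed face-scoped inputs B01-L `Universe.FaceLineField` and B01-C `Universe.FaceSeesawCoupling` of
`CorCM/B01/FaceSkeleton.lean` (RULING B01-R1 (b), lead gen 5, 2026-08-21T05:22Z).  Seat prover-pub-hodgecm2-own-b01-0
(single owner of B01).  Theorems only; nothing cited, nothing asserted.
-/
import Summits.HodgeConjecture.CorCM.B01.FaceSkeleton
import Summits.HodgeConjecture.CorCM.Geometry.PerLShadow
import Summits.HodgeConjecture.CorCM.Model.CMTypeUniverse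
import HarnessLib

/-!
# B01 inputs: binder-inhabitedness, content, and the shadow falsity of B01-L

For the two displayed residual inputs of binder B01 (`CorCM/B01/FaceSkeleton.lean`):

* the `∀`-prefix of B01-L (`F` Galois CM with `6 ≤ [F:ℚ]`, a face `f`, an admissible `ι₁`, a hermitian 3-space `V`;
  and a level `Γ` for its leading `∃`) is that of `PeriodThmF`, inhabited by the tree theorem
  `periodThmF_binders_inhabited` (`ℚ(ζ₇)`, Landherr, Minkowski), so B01-L is not a vacuous `∀` on any universe;
  `Universe.exists_wedge_ne_zero_of_faceLineField` — if B01-L holds on `U` it produces a genuine non-zero wedge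
  `ω₀ ∪ ω₁` of `U_Ψ`-classes on some Picard modular surface of `U`.
* `Universe.faceSeesawCoupling_binders_inhabited` — the `∀`-prefix of B01-C up to the level `Γ` is inhabited, and the
  zero classes satisfy its two membership hypotheses; its LAST hypothesis `ω₀ ∪ ω₁ ≠ 0` is inhabited on `U` exactly when
  a non-zero (12)-wedge exists, in particular under B01-L (`Universe.faceSeesawCoupling_antecedent_of_faceLineField`):
  B01-C is non-vacuous relative to B01-L, and jointly the two inputs produce a genuine non-zero period
  (`Universe.exists_period_ne_zero_of_faceInputs`).
* SHADOW FALSITY (the barrier answer of `HOME/b01/ROUTES-B01.md` §4 in kernel form): on the separating universe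
  `Universe.perLShadow U` of `CorCM/Geometry/PerLShadow.lean` — on which `PerL` and `PerL44` HOLD (given M13/M14 on `U`)
  and `PeriodThmF` FAILS — the input B01-L FAILS as well: over a surface field of degree `∉ {24, 48}` every `U_Ψ(Γ)` of
  the shadow is `⊥` (`Universe.perLShadow_Uiso_eq_bot`), so no non-zero (12)-wedge exists at `F = ℚ(ζ₇)`
  (`Universe.not_faceLineField_perLShadow`).  Hence `∀ U, U.PerL → U.FaceLineField` is false
  (`Universe.not_forall_perL_imp_faceLineField`, relative to M13/M14; `not_forall_perL_imp_faceLineField`,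
  unconditionally, through the CM-type universe): B01-L is a statement about the GEOMETRY of the model universe, not a
  universe-uniform consequence of stage 1's `PerL` — exactly as B01 itself (`not_forall_perL_imp_perLFace`).
-/

noncomputable section

open scoped TensorProduct
open NumberField

namespace Summit.HodgeConjecture.CorCM

open Literature.AlgebraicGeometry.Motives (CMType HodgeStructure)
open Literature.AlgebraicGeometry.Motives.HodgeStructure (EndAction conj)
open Literature.NumberTheory.Automorphic

/-! ### Binder-inhabitedness -/

/- The binders of B01-L are those of `PeriodThmF`: inhabited by the tree theorem `periodThmF_binders_inhabited`
(`CorCM/Geometry/NonVacuity.lean`; `ℚ(ζ₇)`, a face, an admissible `ι₁`, Landherr, a level) — not restated here. -/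

namespace Universe

variable (U : Universe)

/-- **B01-L has content**: if `FaceLineField` holds on `U`, then for some face datum `(F, f, ι₁, V)` and level `Γ`
there are classes `ω₀ ∈ U_{Ψ₀}(Γ)`, `ω₁ ∈ U_{Ψ₁}(Γ)` on the Picard modular surface `P_Γ` of `U` with `ω₀ ∪ ω₁ ≠ 0`.
[folklore] -/
theorem exists_wedge_ne_zero_of_faceLineField (h : U.FaceLineField) :
    ∃ (F : CMField) (_ : IsGalois ℚ F) (_ : 6 ≤ Module.finrank ℚ F) (f : Face F) (ι₁ : F →+* ℂ)
      (_ : f.Admissible ι₁) (V : HermSpace3 F ι₁) (Γ : Level V) (ω₀ ω₁ : U.CohC (U.pms F ι₁ V Γ) 1),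
      ω₀ ∈ U.Uiso Γ F (f.psi 0) ι₁ ∧ ω₁ ∈ U.Uiso Γ F (f.psi 1) ι₁ ∧ U.cup2C (U.pms F ι₁ V Γ) 1 ω₀ ω₁ ≠ 0 := by
  obtain ⟨F, hG, h6, f, ι₁, hf, V, -⟩ := periodThmF_binders_inhabited
  obtain ⟨Γ, ω₀, ω₁, h₀, h₁, hne⟩ := h F hG h6 f ι₁ hf V
  exact ⟨F, hG, h6, f, ι₁, hf, V, Γ, ω₀, ω₁, h₀, h₁, hne⟩

/-- **The binders of B01-C are inhabited up to the level, with the two membership hypotheses**: there are a face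
datum, a level `Γ` and classes `ω₀ ∈ U_{Ψ₀}(Γ)`, `ω₁ ∈ U_{Ψ₁}(Γ)` (the zero classes) — on every universe.  The last
hypothesis `ω₀ ∪ ω₁ ≠ 0` of B01-C is a genuine (12)-wedge supply and is inhabited exactly when one exists on `U`
(`faceSeesawCoupling_antecedent_of_faceLineField`). [folklore] -/
theorem faceSeesawCoupling_binders_inhabited :
    ∃ (F : CMField) (_ : IsGalois ℚ F) (_ : 6 ≤ Module.finrank ℚ F) (f : Face F) (ι₁ : F →+* ℂ)
      (_ : f.Admissible ι₁) (V : HermSpace3 F ι₁) (Γ : Level V) (ω₀ ω₁ : U.CohC (U.pms F ι₁ V Γ) 1),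
      ω₀ ∈ U.Uiso Γ F (f.psi 0) ι₁ ∧ ω₁ ∈ U.Uiso Γ F (f.psi 1) ι₁ := by
  obtain ⟨F, hG, h6, f, ι₁, hf, V, ⟨Γ⟩⟩ := periodThmF_binders_inhabited
  exact ⟨F, hG, h6, f, ι₁, hf, V, Γ, 0, 0, Submodule.zero_mem _, Submodule.zero_mem _⟩

/-- **The full antecedent of B01-C is inhabited under B01-L**: a face datum, a level and classes
`ω₀ ∈ U_{Ψ₀}(Γ)`, `ω₁ ∈ U_{Ψ₁}(Γ)` with `ω₀ ∪ ω₁ ≠ 0`.  So B01-C is non-vacuous relative to B01-L. [folklore] -/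
theorem faceSeesawCoupling_antecedent_of_faceLineField (h : U.FaceLineField) :
    ∃ (F : CMField) (_ : IsGalois ℚ F) (_ : 6 ≤ Module.finrank ℚ F) (f : Face F) (ι₁ : F →+* ℂ)
      (_ : f.Admissible ι₁) (V : HermSpace3 F ι₁) (Γ : Level V) (ω₀ ω₁ : U.CohC (U.pms F ι₁ V Γ) 1),
      ω₀ ∈ U.Uiso Γ F (f.psi 0) ι₁ ∧ ω₁ ∈ U.Uiso Γ F (f.psi 1) ι₁ ∧ U.cup2C (U.pms F ι₁ V Γ) 1 ω₀ ω₁ ≠ 0 :=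
  U.exists_wedge_ne_zero_of_faceLineField h

/-- **Jointly the two inputs produce a genuine non-zero period**: under B01-L and B01-C there are a face datum, a level
`Γ'`, a morphism of surfaces `g` and four classes of the right `U_Ψ`-types whose quadrilinear period is non-zero.
[folklore] -/
theorem exists_period_ne_zero_of_faceInputs (hL : U.FaceLineField) (hC : U.FaceSeesawCoupling) :
    ∃ (F : CMField) (_ : IsGalois ℚ F) (_ : 6 ≤ Module.finrank ℚ F) (f : Face F) (ι₁ : F →+* ℂ)
      (_ : f.Admissible ι₁) (V : HermSpace3 F ι₁) (Γ Γ' : Level V) (g : U.Mor (U.pms F ι₁ V Γ') (U.pms F ι₁ V Γ))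
      (ω₀ ω₁ : U.CohC (U.pms F ι₁ V Γ) 1) (ω₂ ω₃ : U.CohC (U.pms F ι₁ V Γ') 1),
      ω₀ ∈ U.Uiso Γ F (f.psi 0) ι₁ ∧ ω₁ ∈ U.Uiso Γ F (f.psi 1) ι₁ ∧
      ω₂ ∈ U.Uiso Γ' F (f.psi 2) ι₁ ∧ ω₃ ∈ U.Uiso Γ' F (f.psi 3) ι₁ ∧
        U.period (U.pms F ι₁ V Γ') ![U.pullC g 1 ω₀, U.pullC g 1 ω₁, ω₂, ω₃] ≠ 0 := by
  obtain ⟨F, hG, h6, f, ι₁, hf, V, Γ, ω₀, ω₁, h₀, h₁, hne⟩ := U.exists_wedge_ne_zero_of_faceLineField hL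
  obtain ⟨Γ', g, ω₂, ω₃, h₂, h₃, hper⟩ := hC F hG h6 f ι₁ hf V Γ ω₀ ω₁ h₀ h₁ hne
  exact ⟨F, hG, h6, f, ι₁, hf, V, Γ, Γ', g, ω₀, ω₁, ω₂, ω₃, h₀, h₁, h₂, h₃, hper⟩

/-! ### The shadow falsity of B01-L -/

/-- On the PerL shadow, over a surface field of degree `∉ {24, 48}`, every pull-back of a degree-one class to a Picard
modular surface vanishes (the surface is the synthetic `inr false`). [folklore] -/
theorem perLShadow_pullC_pms_eq_zero {L : CMField} (hL : ¬ (Module.finrank ℚ L = 24 ∨ Module.finrank ℚ L = 48))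
    (ι₁ : L →+* ℂ) (V : HermSpace3 L ι₁) (Γ : Level V) (K : CMField) (Ψ : CMType K)
    (F : U.perLShadow.Mor (U.perLShadow.pms L ι₁ V Γ) (U.perLShadow.cmAV K Ψ))
    (α : U.perLShadow.CohC (U.perLShadow.cmAV K Ψ) 1) : U.perLShadow.pullC F 1 α = 0 := by
  have key : ∀ X : U.perLShadow.Var, X = .inr false →
      ∀ (F : U.perLShadow.Mor X (U.perLShadow.cmAV K Ψ)) (α : U.perLShadow.CohC (U.perLShadow.cmAV K Ψ) 1),
        U.perLShadow.pullC F 1 α = 0 := by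
    rintro X rfl F α
    exact U.perLShadow_pullC_inr_false F α
  exact key _ (U.perLShadow_pms_of_not_finrank hL ι₁ V Γ) F α

/-- **On the PerL shadow `U_Ψ(Γ) = ⊥` over every surface field of degree `∉ {24, 48}`.** [folklore] -/
theorem perLShadow_Uiso_eq_bot {L : CMField} (hL : ¬ (Module.finrank ℚ L = 24 ∨ Module.finrank ℚ L = 48))
    (ι₁ : L →+* ℂ) (V : HermSpace3 L ι₁) (Γ : Level V) (K : CMField) (Ψ : CMType K) (σ : K →+* ℂ) :
    U.perLShadow.Uiso Γ K Ψ σ = ⊥ := by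
  rw [eq_bot_iff]
  refine Submodule.span_le.mpr ?_
  rintro ω ⟨F, α, -, rfl⟩
  simp only [SetLike.mem_coe, Submodule.mem_bot]
  exact U.perLShadow_pullC_pms_eq_zero hL ι₁ V Γ K Ψ F α

/-- **B01-L FAILS on the PerL shadow** (of every universe, unconditionally): at the Galois CM field `ℚ(ζ₇)` of degree
`6 ∉ {24, 48}` (a face, an admissible `ι₁`, a hermitian space exist), every `U_Ψ(Γ)` is `⊥`, so no non-zero
(12)-wedge exists.  This is the kernel form of the barrier answer: B01-L speaks about the geometry of the universe and
is false on the separating universe on which `PerL` holds and `PeriodThmF` fails. [folklore] -/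
theorem not_faceLineField_perLShadow : ¬ U.perLShadow.FaceLineField := by
  intro h
  let F : CMField := ⟨CyclotomicField.{0} 7 ℚ⟩
  have hG : IsGalois ℚ F := isGalois_cyclotomicField_seven
  have h6 : Module.finrank ℚ F = 6 := UnitaryGroup.finrank_cyclotomicField_seven
  obtain ⟨f, ι₁, hf⟩ := exists_face_admissible F h6.ge
  obtain ⟨V⟩ := landherr_exists_proof F ι₁
  obtain ⟨Γ, ω₀, ω₁, h₀, -, hne⟩ := h F hG h6.ge f ι₁ hf V
  rw [U.perLShadow_Uiso_eq_bot (by omega) ι₁ V Γ F (f.psi 0) ι₁, Submodule.mem_bot] at h₀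
  exact hne (by rw [h₀, map_zero, LinearMap.zero_apply])

/-- **`PerL ∧ PerL44 ∧ ¬ FaceLineField` is satisfiable** relative to any universe with the CM-type facts M13 + M14
(`Fact_eigenLine`, `Fact_alphaLine`): its PerL shadow is a witness. [folklore] -/
theorem exists_perL_and_not_faceLineField (hE : U.Fact_eigenLine) (hA : U.Fact_alphaLine) :
    ∃ U' : Universe, U'.PerL ∧ U'.PerL44 ∧ ¬ U'.FaceLineField :=
  ⟨U.perLShadow, U.perLShadow_perL hE hA, U.perLShadow_perL44 hE hA, U.not_faceLineField_perLShadow⟩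

/-- **B01-L is not a universe-uniform consequence of `PerL`** (relative to M13 + M14): `∀ U, U.PerL → U.FaceLineField`
is false. [folklore] -/
theorem not_forall_perL_imp_faceLineField (hE : U.Fact_eigenLine) (hA : U.Fact_alphaLine) :
    ¬ ∀ U' : Universe, U'.PerL → U'.FaceLineField :=
  fun h => U.not_faceLineField_perLShadow (h _ (U.perLShadow_perL hE hA))

end Universe

/-- **`PerL ∧ PerL44 ∧ ¬ FaceLineField` is satisfiable, unconditionally**: the PerL shadow of the CM-type universe
(`cmTypeUniverse`, which satisfies M13 + M14). [folklore] -/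
theorem exists_perL_perL44_not_faceLineField : ∃ U : Universe, U.PerL ∧ U.PerL44 ∧ ¬ U.FaceLineField :=
  cmTypeUniverse.exists_perL_and_not_faceLineField cmTypeUniverse_fact_eigenLine cmTypeUniverse_fact_alphaLine

/-- **B01-L is not a universe-uniform consequence of `PerL`, unconditionally**: `∀ U, U.PerL → U.FaceLineField` is
false (so a discharge of B01-L, like one of B01, must use the model universe). [folklore] -/
theorem not_forall_perL_imp_faceLineField : ¬ ∀ U : Universe, U.PerL → U.FaceLineField := by
  intro h
  obtain ⟨U, hP, -, hF⟩ := exists_perL_perL44_not_faceLineField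
  exact hF (h U hP)

/-! ### B01-L is NECESSARY: `PeriodThmF → FaceLineField` on every universe

(Appended 2026-08-21 by the same seat; referee ref-0 g24 note (a) «keep the strengthening visible»: of the two displayed
inputs only B01-C is a strengthening — B01-L is a CONSEQUENCE of the face-form period theorem.) -/

namespace Universe

/-- **B01-L is necessary**: on every universe, `PeriodThmF → FaceLineField` — a period datum
`(Γ, F_i, α_i)` with `∫ F₀^*α₀ ∧ F₁^*α₁ ∧ \overline{F₂^*α₂ ∧ F₃^*α₃} ≠ 0` has in particular `F₀^*α₀ ∪ F₁^*α₁ ≠ 0`, and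
the pure pull-backs `F_i^*α_i` lie in `U_{Ψ_i}(Γ)`.  So of the two displayed inputs of B01 only B01-C
(`FaceSeesawCoupling`) is a strengthening of `PerLFace`; B01-L is implied by it. [folklore] -/
theorem faceLineField_of_periodThmF (U : Universe) (h : U.PeriodThmF) : U.FaceLineField := by
  intro F hG h6 f ι₁ hf V
  obtain ⟨Γ, Fm, α, hα, hper⟩ := h F hG h6 f ι₁ hf V
  refine ⟨Γ, U.pullC (Fm 0) 1 (α 0), U.pullC (Fm 1) 1 (α 1), Submodule.subset_span ⟨Fm 0, α 0, hα 0, rfl⟩,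
    Submodule.subset_span ⟨Fm 1, α 1, hα 1, rfl⟩, ?_⟩
  intro h0
  apply hper
  show U.trC _ 4 (U.cup2C _ 2 (U.cup2C _ 1 (U.pullC (Fm 0) 1 (α 0)) (U.pullC (Fm 1) 1 (α 1))) _) = 0
  rw [h0, map_zero, LinearMap.zero_apply, map_zero]

/-- Hence the two displayed inputs TOGETHER are equivalent, over `Fact_pull_comp`, to «`PeriodThmF` plus the coupling
B01-C»: `FaceLineField ∧ FaceSeesawCoupling → PeriodThmF → FaceLineField`. [folklore] -/
theorem faceLineField_iff_of_faceSeesawCoupling (U : Universe) (hc : U.Fact_pull_comp) (hC : U.FaceSeesawCoupling) :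
    U.FaceLineField ↔ U.PeriodThmF :=
  ⟨fun hL => periodThmF_of_faceInputs hc hL hC, U.faceLineField_of_periodThmF⟩

end Universe

/-- **On the model universe: `PerLFace → FaceLineField`** (B01-L is necessary for B01's conclusion). [folklore] -/
theorem faceLineField_of_perLFace (hHD : Literature.AlgebraicGeometry.HodgeTheory.exists_isReal_hodgeModel)
    (hI : Literature.AlgebraicGeometry.HodgeTheory.hodgePQ_independent_of_hodgeModel)
    (h₁ : Literature.NumberTheory.Automorphic.PicardCM.BallQuotientUniformised)
    (h₃ : Literature.NumberTheory.Automorphic.PicardCM.CMAbelianVarietyRealised)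
    (hP : (Model.picardCMUniverse hHD hI h₁ h₃).PerLFace) :
    (Model.picardCMUniverse hHD hI h₁ h₃).FaceLineField :=
  (Model.picardCMUniverse hHD hI h₁ h₃).faceLineField_of_periodThmF hP

end Summit.HodgeConjecture.CorCM

end
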